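import Literature.AlgebraicGeometry.Frobenioids.ArchimedeanTheoremsInstances
import Literature.AlgebraicGeometry.Frobenioids.ArchimedeanDivisors
import Literature.AlgebraicGeometry.Frobenioids.ElementaryPreFrobenioid
import HarnessLib

/-!
# Frobenioids II, Theorem 3.6 (i) typology and (iv) second sentence (repaired readings): the schemata
# `Thm36i_ampleTypes F`, `Thm36iv_faithful_of_isIsotropic G F Λ`, `Thm36iv_faithful_istr G F Λ`
# (FACT-LIST F-0690, F-0787, F-0695) have REFUTABLE universal closures — they are facts AT THE NAMED
# INSTANCES only (part E)

Mochizuki, *The geometry of Frobenioids II: poly-Frobenioids*, Kyushu J. Math. **62** (2008) 401–460,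
§3, Theorem 3.6 (i) p. 36 ("the Frobenioid `C^Λ` is of `Aut`-ample, `Aut^sub`-ample, `End`-ample, and
metrically trivial type, but not of group-like type") and Theorem 3.6 (iv) p. 37, second sentence ("If,
moreover, `Λ ∈ {ℤ, ℚ}`, then this factorization determines a faithful action of the image of `Aut_F(A)` in
`Aut_{D₀}(A₀)` on `O^▷(A), O^×(A)`"), in the two candidate repaired readings recorded by the statement
file (layer ruling L1 #6: isotropic `A`, resp. through the isotropic hull)
[cite: MochizukiFrdII2008, Thm 3.6 pp.36-38].

Negative knowledge recorded next to `ArchimedeanBasicProperties.lean` (abc-iut-L1-t9), PROOF-ONLY (no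
definition, no instance), abc-iut cell seat abc-iut-f-008 (block F, float; class `preparatory`,
kernel_closedness `parametrised`).  Parts A–D: `ArchimedeanBasicPropertiesSchemaNegative{,B,C,D}.lean`.

The three rows are PARAMETRISED predicates binding the structure functor `F` (and for (iv) the comparison
functor `G` and the label `Λ`) as free parameters; the statement file: "NO OTHER binding is a statement
of the paper".  Kernel objects:

* F-0690 (`Thm36i_ampleTypes`, "… but NOT of group-like type"): the angular Frobenioid `A → F_0` of
  Example 3.3 (iii) over the identity base IS of group-like type (`ArchFrd.A.isOfType_isGroupLikeObj`, its
  divisor monoid is `0`), so the (i)-typology schema fails at `F := A.toElem (𝟭 D₀)` — the printed text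
  asserts it for `C^Λ` only;
* F-0787 / F-0695 (the faithfulness readings of (iv)): the ZERO SECTION `D₀ → F_{Φ₀}`, `f ↦ (f, 0, 1)`
  ([FrdI] Prop. 1.5, `ElemFrobenioid.zeroSection`) as a structure functor on `X := D₀` itself: at
  `A := Spec ℂ` every endomorphism is its own base, so `O^▷(A) = O^×(A) = {id}` and ALL automorphisms act
  identically on them, `A` is isotropic (a pre-step is a base-isomorphism, i.e. an isomorphism) and
  `id_A` is an isotropic hull; but complex conjugation and the identity have DIFFERENT images under the
  faithful comparison functor `D₀ → ArchBase` (`D0.toArchBase_faithful`, `D0.conj_ne_id`).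

Theorems: `not_forall_thm36i_ampleTypes`, `not_forall_thm36iv_faithful_of_isIsotropic`,
`not_forall_thm36iv_faithful_istr` (¬ of the fully quantified closures, universe level `0`), each from a
named ¬-instance.

The INSTANCE forms — the only statements of the paper (resp. of the ruling's repaired readings) — are
PROVED in the tree and are what consumers bind: F-0690 ⟶ `ArchFrd.thm36i_ampleTypes_C` (`D` connected;
`ArchimedeanAmpleness.lean`), `ArchFrd.Thm36Sub.thm36i_ampleTypes_C_holds` (F-0868 at THE data,
`Thm36SubInstancesB.lean`); F-0787 ⟶ `ArchFrd.C0.thm36iv_faithful_of_isIsotropic_C0'`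
(`ArchimedeanAutActionWitness.lean`), `ArchFrd.thm36iv_faithful_of_isIsotropic_C` and the readings package
`ArchFrd.Thm36Sub.thm36iv_readings_CA_holds` (F-0878 at THE data; `ArchimedeanAutActionReadings.lean`,
`Thm36SubInstancesA.lean`); F-0695 ⟶ `ArchFrd.thm36iv_faithful_istr_C` (`ArchimedeanAutActionReadings.lean`)
and the same readings package.  So each row is admissible ONLY in its instance form (FACT-LIST class
«universal-closure REFUTED; instance form PROVED»).  Nothing here bears on the disputed [IUTchIII]
Cor. 3.12 or takes a side; refuted-as-schema is a statement about OUR typing, not about the paper (whose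
printed sentence (iv)-2 is itself flag register L1 #6, `ArchFrd.C0.not_thm36iv_faithful_C0`).
-/

namespace Literature.AlgebraicGeometry.Frobenioids

namespace ArchFrd

open CategoryTheory

/-! ### F-0690: `Thm36i_ampleTypes` -/

/-- **F-0690, universal closure false:** the angular Frobenioid `A → F_0` over the identity base is of
group-like type (`A.isOfType_isGroupLikeObj`), so `Thm36i_ampleTypes (A.toElem (𝟭 D₀))` — whose last clause
is "NOT of group-like type" — fails. [cite: MochizukiFrdII2008, Thm 3.6 (i) p.36] -/
theorem not_thm36i_ampleTypes_A : ¬ Thm36i_ampleTypes (A.toElem (𝟭 D0)) := by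
  rintro ⟨-, -, -, -, hgl⟩
  exact hgl (A.isOfType_isGroupLikeObj (𝟭 D0))

/-- **F-0690 as a schema is not a fact:** the fully quantified closure of `ArchFrd.Thm36i_ampleTypes` (at
universe level `0`) is FALSE; the printed typology of `C^Λ` is `ArchFrd.thm36i_ampleTypes_C` /
`Thm36Sub.thm36i_ampleTypes_C_holds` (F-0868). [cite: MochizukiFrdII2008, Thm 3.6 (i) p.36] -/
theorem not_forall_thm36i_ampleTypes :
    ¬ ∀ {D : Type} [Category.{0} D] {Φ : Dᵒᵖ ⥤ CommMonCat.{0}} {X : Type} [Category.{0} X]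
        (F : X ⥤ ElemFrobenioid Φ), Thm36i_ampleTypes F :=
  fun h => not_thm36i_ampleTypes_A (h _)

/-! ### The zero-section structure functor `D₀ → F_{Φ₀}` at `Spec ℂ` -/

namespace SchemaNegE

/-- For the zero section `D₀ → F_{Φ₀}` every object is isotropic: a pre-step is in particular a
base-isomorphism, and the base of an arrow is the arrow itself. [cite: MochizukiFrdI2008, Def. 1.2 (iv) p.23] -/
theorem isIsotropic_zeroSection (K : D0) :
    PreFrobenioid.IsIsotropic (ElemFrobenioid.zeroSection Φ₀) K :=
  fun _ _ _ hpre => hpre.2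

/-- Complex conjugation as an automorphism of `Spec ℂ` in `D₀`. [cite: MochizukiFrdII2008, §3 p.23] -/
theorem conj_comp_conj' : D0.conj ≫ D0.conj = 𝟙 D0.complex := D0.conj_comp_conj

/-- At `Spec ℂ`, all automorphisms act identically (with the identity) on `O^▷` for the zero section:
an element of `O^▷(Spec ℂ)` is a base-identity endomorphism, i.e. the identity.
[cite: MochizukiFrdII2008, Thm 3.6 (iv) p.37] -/
theorem conj_act_endSubmonoid (α α' : D0.complex ≅ D0.complex) :
    ∀ f ∈ PreFrobenioid.endSubmonoid (ElemFrobenioid.zeroSection Φ₀) D0.complex,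
      α.inv ≫ f ≫ α.hom = α'.inv ≫ f ≫ α'.hom := by
  rintro f ⟨hb, -⟩
  change f = 𝟙 D0.complex at hb
  subst hb
  simp

/-- At `Spec ℂ`, all automorphisms act identically on `O^×` for the zero section (`O^× = {id}`).
[cite: MochizukiFrdII2008, Thm 3.6 (iv) p.37] -/
theorem conj_act_unitsSubgroup (α α' : D0.complex ≅ D0.complex) :
    ∀ u ∈ PreFrobenioid.unitsSubgroup (ElemFrobenioid.zeroSection Φ₀) D0.complex,
      α.symm ≪≫ u ≪≫ α = α'.symm ≪≫ u ≪≫ α' := by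
  rintro u ⟨hb, -⟩
  change u.hom = 𝟙 D0.complex at hb
  ext
  simp [hb]

/-- Complex conjugation and the identity of `Spec ℂ` have different images under the comparison functor
`D₀ → ArchBase` (which is faithful). [cite: MochizukiFrdII2008, §3 p.23] -/
theorem mapIso_conj_ne (α : D0.complex ≅ D0.complex) (hα : α.hom = D0.conj) :
    (PreFrobenioid.baseFunctor (ElemFrobenioid.zeroSection Φ₀) ⋙ D0.toArchBase).mapIso α ≠
      (PreFrobenioid.baseFunctor (ElemFrobenioid.zeroSection Φ₀) ⋙ D0.toArchBase).mapIso (Iso.refl _) := by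
  intro h
  have h' := congrArg Iso.hom h
  change D0.toArchBase.map α.hom = D0.toArchBase.map (𝟙 D0.complex) at h'
  rw [hα] at h'
  haveI := D0.toArchBase_faithful
  exact D0.conj_ne_id (D0.toArchBase.map_injective h')

end SchemaNegE

open SchemaNegE

/-! ### F-0787: `Thm36iv_faithful_of_isIsotropic` -/

/-- **F-0787, universal closure false:** for the zero section `D₀ → F_{Φ₀}` (comparison functor the
faithful `D₀ → ArchBase`, `Λ := ℤ`), the isotropic object `Spec ℂ` has `O^▷ = O^× = {id}`, on which
complex conjugation and the identity act identically — yet their images in `Aut(Spec ℂ)` differ.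
[cite: MochizukiFrdII2008, Thm 3.6 (iv) p.37] -/
theorem not_thm36iv_faithful_of_isIsotropic_zeroSection :
    ¬ Thm36iv_faithful_of_isIsotropic D0.toArchBase (ElemFrobenioid.zeroSection Φ₀) MonoidType.Z := by
  intro h
  let α : D0.complex ≅ D0.complex := ⟨D0.conj, D0.conj, conj_comp_conj', conj_comp_conj'⟩
  exact mapIso_conj_ne α rfl (h (by decide) D0.complex (isIsotropic_zeroSection _) α (Iso.refl _)
    (conj_act_endSubmonoid α (Iso.refl _)) (conj_act_unitsSubgroup α (Iso.refl _)))

/-- **F-0787 as a schema is not a fact:** the fully quantified closure of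
`ArchFrd.Thm36iv_faithful_of_isIsotropic` (at universe level `0`) is FALSE; the reading HOLDS at the
categories of Example 3.3: `ArchFrd.C0.thm36iv_faithful_of_isIsotropic_C0'`,
`ArchFrd.thm36iv_faithful_of_isIsotropic_C`, `Thm36Sub.thm36iv_readings_CA_holds` (F-0878).
[cite: MochizukiFrdII2008, Thm 3.6 (iv) p.37] -/
theorem not_forall_thm36iv_faithful_of_isIsotropic :
    ¬ ∀ {D : Type} [Category.{0} D] (G : D ⥤ ArchBase) {Φ : Dᵒᵖ ⥤ CommMonCat.{0}} {X : Type}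
        [Category.{0} X] (F : X ⥤ ElemFrobenioid Φ) (Λ : MonoidType),
        Thm36iv_faithful_of_isIsotropic G F Λ :=
  fun h => not_thm36iv_faithful_of_isIsotropic_zeroSection (h _ _ _)

/-! ### F-0695: `Thm36iv_faithful_istr` -/

/-- **F-0695, universal closure false:** the same zero section, with the isotropic hull `id : Spec ℂ → Spec ℂ`
and `β := α` (conjugation), `β' := α' := id`: the hull squares commute, the actions on
`O^▷(Spec ℂ) = O^×(Spec ℂ) = {id}` coincide, but the images of `α, α'` differ.
[cite: MochizukiFrdII2008, Thm 3.6 (iv) p.37] -/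
theorem not_thm36iv_faithful_istr_zeroSection :
    ¬ Thm36iv_faithful_istr D0.toArchBase (ElemFrobenioid.zeroSection Φ₀) MonoidType.Z := by
  intro h
  let α : D0.complex ≅ D0.complex := ⟨D0.conj, D0.conj, conj_comp_conj', conj_comp_conj'⟩
  have hhull : PreFrobenioid.IsIsotropicHull (ElemFrobenioid.zeroSection Φ₀) (𝟙 D0.complex) := by
    refine ⟨PreFrobenioid.div_id _ _, ⟨PreFrobenioid.degFr_id _ _, ?_⟩, isIsotropic_zeroSection _,
      fun C' γ _ => ⟨γ, Category.id_comp γ, fun β hβ => ?_⟩⟩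
    · change IsIso (PreFrobenioid.Base (ElemFrobenioid.zeroSection Φ₀) (𝟙 D0.complex))
      rw [PreFrobenioid.base_id]
      infer_instance
    · rw [← hβ, Category.id_comp]
  refine mapIso_conj_ne α rfl (h (by decide) D0.complex D0.complex (𝟙 _) hhull α (Iso.refl _) α
    (Iso.refl _) (by simp) (by simp) (conj_act_endSubmonoid α (Iso.refl _))
    (conj_act_unitsSubgroup α (Iso.refl _)))

/-- **F-0695 as a schema is not a fact:** the fully quantified closure of `ArchFrd.Thm36iv_faithful_istr`
(at universe level `0`) is FALSE; the reading HOLDS at the categories of Example 3.3: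
`ArchFrd.thm36iv_faithful_istr_C`, `Thm36Sub.thm36iv_readings_CA_holds` (F-0878).
[cite: MochizukiFrdII2008, Thm 3.6 (iv) p.37] -/
theorem not_forall_thm36iv_faithful_istr :
    ¬ ∀ {D : Type} [Category.{0} D] (G : D ⥤ ArchBase) {Φ : Dᵒᵖ ⥤ CommMonCat.{0}} {X : Type}
        [Category.{0} X] (F : X ⥤ ElemFrobenioid Φ) (Λ : MonoidType), Thm36iv_faithful_istr G F Λ :=
  fun h => not_thm36iv_faithful_istr_zeroSection (h _ _ _)

end ArchFrd

end Literature.AlgebraicGeometry.Frobenioids
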